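import Mathlib
import Literature.AlgebraicGeometry.Resolution.KnafKuhlmann2009Lemma21
import Literature.AlgebraicGeometry.Resolution.SubfieldTransport
import Summits.ResolutionOfSingularities.ResolutionOfSingularities.Theorems.AbhyankarShadowsRationalSuffices
import HarnessLib

/-!
# Saturation of a rational rank-one valuation in the algebraic closure (`stub_rankOneSaturation`)

Crux `SemivaluationShadows` (item `stmt-ResolutionOfSingularities-16757`, route
`ResolutionOfSingularities/AbhyankarShadows`), line `birth`, registered sub-goal
`stub_rankOneSaturation`, PROVED: `rankOneSaturation` (binder form, for an arbitrary algebraic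
extension `M/K` carrying a compatible `k`-algebra structure: `rankOneSaturation_of`) and
`stub_rankOneSaturation` (the registered one-term signature, by name).

**Statement.** `k` algebraically closed, `K ⊇ k` a field, `O ∋ k` a valuation ring of `K` which
is RATIONAL (every element of `O` is a constant of `k` modulo `𝔪_O`) of rational rank one
(`finrank ℤ (Additive Γˣ) = 1`), `0 ≠ t ∈ K` of value `< 1`. Then there is a valuation ring `V`
of the algebraic closure `M = K̄` with
* (a) `V ∩ K = O` (Chevalley);
* (b) the value of every `z ≠ 0` of `M` is torsion over the value of `t`:
  `v(z)^N = v(t)^m` with `N ≥ 1`, `m ∈ ℤ`;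
* (c) `V` is again rational over `k`: every `u` of value `1` is a constant modulo `𝔪_V`;
* (d)–(f) `v` on `K` and `V.valuation ∘ (K → M)` are equivalent valuations
  (`<1`, `=`, `≤` correspond).

**Proof.** (a) is the tree's `exists_valuationSubring_comap_eq` (Chevalley extension);
(d)–(f) are `isEquiv_valuation_comap` (same valuation ring ⇒ equivalent valuations).
(b): `z` is algebraic over `K`, so `v(z)^n = v(x)` for some `n ≥ 1`, `0 ≠ x ∈ K` (tree
`exists_valuation_pow_eq_of_isAlgebraic`: two monomials of a vanishing sum have the same value);
and in the torsion-free group `Γˣ` of rational rank one the elements `v(x)`, `v(t)` are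
`ℤ`-dependent (an independent pair would give `rank ≥ 2`), the coefficient of `v(x)` being
non-zero because `v(t) ≠ 1` is not torsion (`exists_pow_eq_zpow_of_finrank_eq_one`).
(c): take a relation `∑ aᵢ uⁱ = 0` over `K`, divide by the coefficient of largest value (so
that all coefficients lie in `O`, one of them being `1`), replace each coefficient by the
constant `cᵢ ∈ k` congruent to it modulo `𝔪_O` (rationality of `O`): the resulting NON-ZERO
`g ∈ k[X]` has `v(g(u)) < 1` by the ultrametric inequality
(`exists_polynomial_valuation_aeval_lt_one`), and since `k = k̄` the polynomial `g` splits
into linear factors, one of which must have value `< 1` at `u` (tree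
`exists_valuation_sub_algebraMap_lt_one`).

## Sources

* S. S. Abhyankar, *Ramification theoretic methods in algebraic geometry*, Annals of
  Mathematics Studies 43, Princeton (1959), §2 (extension of valuations to algebraic extensions:
  value group torsion over the base, residue field algebraic). [folklore]
* O. Zariski, P. Samuel, *Commutative Algebra* II, Ch. VI §§4, 11. [folklore]
-/

-- single-problem summit: the doubled namespace component `ResolutionOfSingularities` is forced
set_option linter.dupNamespace false

noncomputable section

open Literature.AlgebraicGeometry.Resolution

namespace Summit.ResolutionOfSingularities.ResolutionOfSingularities.Theorems

/-! ## Rational rank one: any two values are `ℤ`-dependent -/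

/-- **Rational rank one.** In a linearly ordered commutative group with zero whose unit group
`Γˣ` has `finrank ℤ (Additive Γˣ) = 1`, every non-zero `a` is rationally dependent on any
non-zero `b ≠ 1`: `a ^ N = b ^ m` for some `N ≥ 1` and `m ∈ ℤ`. Indeed `a, b` cannot be
`ℤ`-linearly independent in `Additive Γˣ` (that would force `rank ≥ 2`), and in a non-trivial
relation `a^s b^{s'} = 1` the exponent `s` is non-zero since `b ≠ 1` is not torsion.
[folklore] -/
theorem exists_pow_eq_zpow_of_finrank_eq_one {Γ₀ : Type*} [LinearOrderedCommGroupWithZero Γ₀]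
    (h1 : Module.finrank ℤ (Additive Γ₀ˣ) = 1) {a b : Γ₀} (ha : a ≠ 0) (hb : b ≠ 0)
    (hb1 : b ≠ 1) : ∃ N : ℕ, N ≠ 0 ∧ ∃ m : ℤ, a ^ N = b ^ m := by
  have hrank : Module.rank ℤ (Additive Γ₀ˣ) = 1 := by
    have h := h1
    rw [Module.finrank] at h
    exact Cardinal.toNat_eq_one.mp h
  set A : Additive Γ₀ˣ := Additive.ofMul (Units.mk0 a ha) with hA
  set B : Additive Γ₀ˣ := Additive.ofMul (Units.mk0 b hb) with hB
  -- a non-trivial `ℤ`-relation between `A` and `B`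
  have hdep : ∃ s s' : ℤ, (s ≠ 0 ∨ s' ≠ 0) ∧ s • A + s' • B = 0 := by
    by_contra hdep
    have hli : LinearIndependent ℤ ![A, B] := LinearIndependent.pair_iff.mpr fun s s' hst => by
      by_contra hne
      exact hdep ⟨s, s', not_and_or.mp hne, hst⟩
    have h2 := hli.cardinal_lift_le_rank
    rw [hrank, Cardinal.mk_fin, Cardinal.lift_natCast, Cardinal.lift_one] at h2
    norm_num at h2
  obtain ⟨s, s', hss', hrel⟩ := hdep
  -- in `Γ₀`: `a ^ s * b ^ s' = 1`
  have hrel' : a ^ s * b ^ s' = 1 := by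
    have h := congrArg (fun z : Additive Γ₀ˣ => ((Additive.toMul z : Γ₀ˣ) : Γ₀)) hrel
    simpa [hA, hB, toMul_add, toMul_zsmul, Units.val_mul, Units.val_zpow_eq_zpow_val] using h
  have hs : s ≠ 0 := by
    rintro rfl
    have hs' : s' ≠ 0 := hss'.resolve_left fun h => h rfl
    rw [zpow_zero, one_mul] at hrel'
    exact hs' ((zpow_eq_one_iff_right₀ zero_le hb1).mp hrel')
  -- `a ^ s = b ^ (-s')`
  have has : a ^ s = b ^ (-s') := by
    rw [zpow_neg]
    exact eq_inv_of_mul_eq_one_left hrel'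
  refine ⟨s.natAbs, Int.natAbs_ne_zero.mpr hs, ?_⟩
  rcases Int.natAbs_eq s with h | h
  · refine ⟨-s', ?_⟩
    rw [← zpow_natCast, ← h, has]
  · refine ⟨s', ?_⟩
    have h' : ((s.natAbs : ℕ) : ℤ) = -s := by omega
    rw [← zpow_natCast, h', zpow_neg, has, zpow_neg, inv_inv]

/-! ## Residues along an algebraic extension of a rational valuation ring -/

/-- **A non-zero polynomial over the constants vanishing at `u` modulo `𝔪_V`.** Let `O` be a
valuation ring of `K` which is rational over `k` (every element of `O` is a constant modulo
`𝔪_O`), `V` a valuation ring of an extension `M ⊇ K` with `V ∩ K = O`, and `u ∈ V` algebraic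
over `K`. Then `v(g(u)) < 1` for some non-zero `g ∈ k[X]`: normalise a relation `∑ aᵢ uⁱ = 0`
by the coefficient of largest value (all coefficients then lie in `O`, one equals `1`) and
replace each coefficient by the constant congruent to it; the difference has all coefficients
in `𝔪_O`, hence value `< 1` at `u` (ultrametric inequality), and the coefficient replacing `1`
is non-zero. [folklore] -/
theorem exists_polynomial_valuation_aeval_lt_one {k K M : Type*} [Field k] [Field K]
    [Algebra k K] [Field M] [Algebra K M] [Algebra k M] [IsScalarTower k K M]
    (O : ValuationSubring K)
    (hrat : ∀ x : K, x ∈ O → ∃ c : k, O.valuation (x - algebraMap k K c) < 1)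
    (V : ValuationSubring M) (hV : V.comap (algebraMap K M) = O) {u : M}
    (hu : V.valuation u ≤ 1) (halg : IsAlgebraic K u) :
    ∃ g : Polynomial k, g ≠ 0 ∧ V.valuation (Polynomial.aeval u g) < 1 := by
  classical
  obtain ⟨p, hp0, hpu⟩ := halg
  set s := p.support with hsdef
  have hs : s.Nonempty := Polynomial.nonempty_support_iff.mpr hp0
  obtain ⟨j, hj, hjmax⟩ := Finset.exists_max_image s (fun i => O.valuation (p.coeff i)) hs
  set a : K := p.coeff j with hadef
  have ha0 : a ≠ 0 := Polynomial.mem_support_iff.mp hj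
  have hva0 : O.valuation a ≠ 0 := (map_ne_zero O.valuation).mpr ha0
  -- the normalised coefficients `a⁻¹ aᵢ` lie in `O`
  have hdO : ∀ i, a⁻¹ * p.coeff i ∈ O := by
    intro i
    by_cases hi : i ∈ s
    · rw [← O.valuation_le_one_iff, map_mul, map_inv₀,
        inv_mul_le_one₀ (zero_lt_iff.mpr hva0)]
      exact hjmax i hi
    · have : p.coeff i = 0 := Polynomial.notMem_support_iff.mp hi
      rw [this, mul_zero]
      exact O.zero_mem
  -- constants congruent to them
  choose c hc using fun i => hrat (a⁻¹ * p.coeff i) (hdO i)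
  let g : Polynomial k := ∑ i ∈ s, Polynomial.C (c i) * Polynomial.X ^ i
  have hgcoeff : ∀ i, g.coeff i = if i ∈ s then c i else 0 := fun i => by
    simp only [g, Polynomial.finsetSum_coeff, Polynomial.coeff_C_mul_X_pow, Finset.sum_ite_eq]
  -- the coefficient replacing `a⁻¹ a_j = 1` is non-zero
  have hcj : c j ≠ 0 := by
    intro h0
    have h := hc j
    rw [h0, map_zero, sub_zero, inv_mul_cancel₀ ha0, map_one] at h
    exact lt_irrefl _ h
  have hg0 : g ≠ 0 := by
    intro h0
    have h := hgcoeff j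
    rw [h0, Polynomial.coeff_zero, if_pos hj] at h
    exact hcj h.symm
  refine ⟨g, hg0, ?_⟩
  -- `g(u) = g(u) - a⁻¹ p(u) = ∑ (cᵢ - a⁻¹ aᵢ) uⁱ`
  have hsum0 : ∑ i ∈ s, algebraMap K M (a⁻¹ * p.coeff i) * u ^ i = 0 := by
    have h : ∑ i ∈ s, algebraMap K M (p.coeff i) * u ^ i = 0 := by
      have h := hpu
      rw [Polynomial.aeval_def, Polynomial.eval₂_eq_sum, Polynomial.sum_def] at h
      exact h
    calc ∑ i ∈ s, algebraMap K M (a⁻¹ * p.coeff i) * u ^ i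
        = algebraMap K M a⁻¹ * ∑ i ∈ s, algebraMap K M (p.coeff i) * u ^ i := by
          rw [Finset.mul_sum]
          refine Finset.sum_congr rfl fun i _ => ?_
          rw [map_mul, mul_assoc]
      _ = 0 := by rw [h, mul_zero]
  have hgu : Polynomial.aeval u g = ∑ i ∈ s, algebraMap k M (c i) * u ^ i := by
    simp only [g, map_sum, map_mul, map_pow, Polynomial.aeval_C, Polynomial.aeval_X]
  have hdiff : Polynomial.aeval u g =
      ∑ i ∈ s, algebraMap K M (algebraMap k K (c i) - a⁻¹ * p.coeff i) * u ^ i := by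
    rw [hgu, ← sub_zero (∑ i ∈ s, algebraMap k M (c i) * u ^ i), ← hsum0,
      ← Finset.sum_sub_distrib]
    refine Finset.sum_congr rfl fun i _ => ?_
    rw [map_sub, sub_mul, IsScalarTower.algebraMap_apply k K M]
  rw [hdiff]
  refine V.valuation.map_sum_lt one_ne_zero fun i _ => ?_
  rw [map_mul, map_pow]
  have h1 : V.valuation (algebraMap K M (algebraMap k K (c i) - a⁻¹ * p.coeff i)) < 1 := by
    rw [valuation_map_lt_one_iff (algebraMap K M) hV, Valuation.map_sub_swap]
    exact hc i
  exact mul_lt_one_of_lt_of_le h1 (pow_le_one' hu i)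

/-! ## The saturation theorem -/

/-- **Saturation along an algebraic extension** (general form of `rankOneSaturation`): for `k`
algebraically closed, `O ∋ k` a rational valuation ring of `K` of rational rank one, `0 ≠ t`
of value `< 1`, and ANY algebraic extension `M/K` (with its `k`-algebra structure through
`K`), there is a valuation ring `V` of `M` with `V ∩ K = O` whose values are torsion over
`v(t)`, which is again rational over `k`, and whose valuation restricts to one equivalent to
`v_O`. [folklore] -/
theorem rankOneSaturation_of {k K M : Type} [Field k] [IsAlgClosed k] [Field K] [Algebra k K]
    [Field M] [Algebra K M] [Algebra k M] [IsScalarTower k K M] [Algebra.IsAlgebraic K M]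
    (O : ValuationSubring K) (hk : ∀ c : k, algebraMap k K c ∈ O)
    (hrat : ∀ x : K, x ∈ O → ∃ c : k, O.valuation (x - algebraMap k K c) < 1)
    (hrr : Module.finrank ℤ (Additive (O.ValueGroup)ˣ) = 1) (t : K) (ht0 : t ≠ 0)
    (ht1 : O.valuation t < 1) :
    ∃ V : ValuationSubring M, V.comap (algebraMap K M) = O ∧
      (∀ z : M, z ≠ 0 → ∃ N : ℕ, N ≠ 0 ∧ ∃ m : ℤ,
        V.valuation z ^ N = V.valuation (algebraMap K M t) ^ m) ∧
      (∀ u : M, V.valuation u = 1 →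
        ∃ c : k, V.valuation (u - algebraMap K M (algebraMap k K c)) < 1) ∧
      (∀ x : K, O.valuation x < 1 ↔ V.valuation (algebraMap K M x) < 1) ∧
      (∀ x x' : K, O.valuation x = O.valuation x' ↔
        V.valuation (algebraMap K M x) = V.valuation (algebraMap K M x')) ∧
      (∀ x x' : K, O.valuation x ≤ O.valuation x' ↔
        V.valuation (algebraMap K M x) ≤ V.valuation (algebraMap K M x')) := by
  -- (a) Chevalley
  obtain ⟨V, hV⟩ := exists_valuationSubring_comap_eq (Ω := M) O
  have he := isEquiv_valuation_comap (algebraMap K M) hV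
  refine ⟨V, hV, ?_, ?_, ?_, ?_, ?_⟩
  · -- (b) values are torsion over `v(t)`
    intro z hz
    have halgK : IsAlgebraic K z := Algebra.IsAlgebraic.isAlgebraic z
    have halg : IsAlgebraic (algebraMap K M).fieldRange z :=
      halgK.ringHom_of_comp_eq (B := M) (algebraMap K M).rangeRestrictField (RingHom.id M)
        (RingHom.rangeRestrictField_bijective _).1 (RingHom.ext fun _ => rfl)
    obtain ⟨n, hn, b, hb, hzb⟩ := exists_valuation_pow_eq_of_isAlgebraic V halg hz
    obtain ⟨x, rfl⟩ := RingHom.mem_fieldRange.mp hb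
    have hx0 : x ≠ 0 := by
      rintro rfl
      rw [map_zero, map_zero, map_pow, pow_eq_zero_iff hn, map_eq_zero] at hzb
      exact hz hzb
    obtain ⟨N, hN, m, hm⟩ := exists_pow_eq_zpow_of_finrank_eq_one hrr
      ((map_ne_zero O.valuation).mpr hx0) ((map_ne_zero O.valuation).mpr ht0) ht1.ne
    -- transport `v(x)^N = v(t)^m` to `V`
    have hm' : V.valuation (algebraMap K M x) ^ N = V.valuation (algebraMap K M t) ^ m := by
      have h : O.valuation (x ^ N) = O.valuation (t ^ m) := by rw [map_pow, map_zpow₀, hm]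
      rw [← valuation_map_eq_iff (algebraMap K M) hV] at h
      rwa [map_pow, map_zpow₀, map_pow, map_zpow₀] at h
    refine ⟨n * N, mul_ne_zero hn hN, m, ?_⟩
    rw [pow_mul, ← map_pow, hzb, hm']
  · -- (c) residues are constants
    intro u hu
    have hkV : ∀ c : k, algebraMap k M c ∈ V := fun c => by
      have h := hk c
      rw [← hV] at h
      rw [IsScalarTower.algebraMap_apply k K M]
      exact ValuationSubring.mem_comap.mp h
    obtain ⟨g, hg0, hlt⟩ := exists_polynomial_valuation_aeval_lt_one O hrat V hV hu.le
      (Algebra.IsAlgebraic.isAlgebraic u)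
    obtain ⟨c, hc⟩ := exists_valuation_sub_algebraMap_lt_one V hkV u
      ⟨g, hg0, V.mem_nonunits_iff.mpr hlt⟩
    exact ⟨c, by rwa [IsScalarTower.algebraMap_apply k K M] at hc⟩
  · -- (d)
    intro x
    exact (valuation_map_lt_one_iff (algebraMap K M) hV x).symm
  · -- (e)
    intro x x'
    exact (valuation_map_eq_iff (algebraMap K M) hV x x').symm
  · -- (f)
    intro x x'
    exact (he x x').symm

/-- **Rank-one saturation in the algebraic closure** (binder form of the registered sub-goal
`stub_rankOneSaturation`): `k` algebraically closed, `O ∋ k` a rational valuation ring of `K`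
of rational rank one, `0 ≠ t` of value `< 1`; then some valuation ring `V` of `M = K̄` has
(a) `V ∩ K = O`, (b) all values torsion over `v(t)`, (c) all residues constants of `k`, and
(d)–(f) `v_O` and `v_V ∘ (K → M)` compare `< 1`, `=`, `≤` identically. [folklore] -/
theorem rankOneSaturation (k K : Type) [Field k] [IsAlgClosed k] [Field K] [Algebra k K]
    (O : ValuationSubring K) (hk : ∀ c : k, algebraMap k K c ∈ O)
    (hrat : ∀ x : K, x ∈ O → ∃ c : k, O.valuation (x - algebraMap k K c) < 1)
    (hrr : Module.finrank ℤ (Additive (O.ValueGroup)ˣ) = 1) (t : K) (ht0 : t ≠ 0)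
    (ht1 : O.valuation t < 1) :
    ∃ V : ValuationSubring (AlgebraicClosure K),
      V.comap (algebraMap K (AlgebraicClosure K)) = O ∧
      (∀ z : AlgebraicClosure K, z ≠ 0 → ∃ N : ℕ, N ≠ 0 ∧ ∃ m : ℤ,
        V.valuation z ^ N = V.valuation (algebraMap K (AlgebraicClosure K) t) ^ m) ∧
      (∀ u : AlgebraicClosure K, V.valuation u = 1 →
        ∃ c : k, V.valuation (u - algebraMap K (AlgebraicClosure K) (algebraMap k K c)) < 1) ∧
      (∀ x : K, O.valuation x < 1 ↔ V.valuation (algebraMap K (AlgebraicClosure K) x) < 1) ∧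
      (∀ x x' : K, O.valuation x = O.valuation x' ↔
        V.valuation (algebraMap K (AlgebraicClosure K) x) =
          V.valuation (algebraMap K (AlgebraicClosure K) x')) ∧
      (∀ x x' : K, O.valuation x ≤ O.valuation x' ↔
        V.valuation (algebraMap K (AlgebraicClosure K) x) ≤
          V.valuation (algebraMap K (AlgebraicClosure K) x')) :=
  rankOneSaturation_of (M := AlgebraicClosure K) O hk hrat hrr t ht0 ht1

/-! ## The registered sub-goal, by name -/

/-- **SUB-GOAL `stub_rankOneSaturation` of line `birth` of crux `SemivaluationShadows`, PROVED**
(the registered one-term signature, by name): saturation of a rational rank-one valuation ring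
`O ∋ k = k̄` of `K` in the algebraic closure `K̄` — an extension `V` with `V ∩ K = O`, values
torsion over `v(t)`, residues constants, and `v_O`, `v_V` comparing identically on `K` —
`rankOneSaturation`. [folklore] -/
theorem stub_rankOneSaturation : ∀ (k K : Type) [Field k] [IsAlgClosed k] [Field K] [Algebra k K] (O : ValuationSubring K), (∀ c : k, algebraMap k K c ∈ O) → (∀ x : K, x ∈ O → ∃ c : k, O.valuation (x - algebraMap k K c) < 1) → Module.finrank ℤ (Additive (O.ValueGroup)ˣ) = 1 → ∀ (t : K), t ≠ 0 → O.valuation t < 1 → ∃ V : ValuationSubring (AlgebraicClosure K), V.comap (algebraMap K (AlgebraicClosure K)) = O ∧ (∀ z : AlgebraicClosure K, z ≠ 0 → ∃ N : ℕ, N ≠ 0 ∧ ∃ m : ℤ, V.valuation z ^ N = V.valuation (algebraMap K (AlgebraicClosure K) t) ^ m) ∧ (∀ u : AlgebraicClosure K, V.valuation u = 1 → ∃ c : k, V.valuation (u - algebraMap K (AlgebraicClosure K) (algebraMap k K c)) < 1) ∧ (∀ x : K, O.valuation x < 1 ↔ V.valuation (algebraMap K (AlgebraicClosure K) x) < 1)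 ∧ (∀ x x' : K, O.valuation x = O.valuation x' ↔ V.valuation (algebraMap K (AlgebraicClosure K) x) = V.valuation (algebraMap K (AlgebraicClosure K) x')) ∧ (∀ x x' : K, O.valuation x ≤ O.valuation x' ↔ V.valuation (algebraMap K (AlgebraicClosure K) x) ≤ V.valuation (algebraMap K (AlgebraicClosure K) x')) := by
  intro k K _ _ _ _ O hk hrat hrr t ht0 ht1
  exact rankOneSaturation k K O hk hrat hrr t ht0 ht1

end Summit.ResolutionOfSingularities.ResolutionOfSingularities.Theorems

end
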